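import Literature.MathematicalPhysics.QuantumLattice.GaugeGroups
import HarnessLib

/-!
# `U(n)` is not a simple compact group — discharge of `not_isSimpleCompactGroup_unitaryGroup`

Topic `Literature/MathematicalPhysics/QuantumLattice`; discharges the named fact
`Literature.MathematicalPhysics.QuantumLattice.not_isSimpleCompactGroup_unitaryGroup`
(`GaugeGroups.lean`; Bröcker–tom Dieck I (1.9)–(1.10), Sepanski §1.3), the one unproved fact in the
import cone of `Summits/QuantumFields/QCD/Statement.lean` (items `UnitaryGroupNotSimple` of the QCD
routes). Proof: if the index type has two distinct elements, the scalar circle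
`{z • 1 : |z| = 1} = range (z ↦ z • 1)` is a closed (compact image), connected (continuous image of
the path-connected `Circle`), normal (central) subgroup of `U(n)` which is neither `⊥` (it contains
`-1`) nor `⊤` (the diagonal unitary `diag(…, 1, …, -1, …)` is not scalar); if the index type is a
subsingleton, `U(n)` is abelian, contradicting the non-commutativity clause.
-/

noncomputable section

namespace Literature.MathematicalPhysics.QuantumLattice

open Matrix

section Scalar

variable {n : Type*} [DecidableEq n] [Fintype n]

/-- The scalar unitary `z • 1` for `z` on the unit circle. [folklore] -/
def scalarUnitary (z : Circle) : Matrix.unitaryGroup n ℂ :=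
  ⟨(z : ℂ) • (1 : Matrix n n ℂ), by
    have hz : (z : ℂ) * star (z : ℂ) = 1 := by
      rw [Complex.star_def, ← Circle.coe_inv_eq_conj, ← Circle.coe_mul, mul_inv_cancel, Circle.coe_one]
    rw [Matrix.mem_unitaryGroup_iff, star_eq_conjTranspose, conjTranspose_smul, conjTranspose_one,
      Matrix.smul_mul, Matrix.mul_smul, Matrix.mul_one, smul_smul, hz, one_smul]⟩

/-- The underlying matrix of `scalarUnitary z` is `z • 1`. [folklore] -/
@[simp] theorem coe_scalarUnitary (z : Circle) :
    ((scalarUnitary z : Matrix.unitaryGroup n ℂ) : Matrix n n ℂ) = (z : ℂ) • (1 : Matrix n n ℂ) := rfl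

/-- `z ↦ z • 1` as a group homomorphism `Circle →* U(n)`. [folklore] -/
def scalarUnitaryHom : Circle →* Matrix.unitaryGroup n ℂ where
  toFun := scalarUnitary
  map_one' := Subtype.ext <| by simp [coe_scalarUnitary]
  map_mul' := fun z w => Subtype.ext <| by
    simp only [Submonoid.coe_mul, coe_scalarUnitary, Circle.coe_mul, Matrix.mul_smul,
      Matrix.mul_one, smul_smul, mul_comm]

/-- Unfolding of `scalarUnitaryHom`. [folklore] -/
@[simp] theorem scalarUnitaryHom_apply (z : Circle) :
    (scalarUnitaryHom z : Matrix.unitaryGroup n ℂ) = scalarUnitary z := rfl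

/-- `z ↦ z • 1` is continuous into `U(n)`. [folklore] -/
theorem continuous_scalarUnitaryHom : Continuous (scalarUnitaryHom : Circle → Matrix.unitaryGroup n ℂ) :=
  Continuous.subtype_mk (continuous_subtype_val.smul continuous_const) _

/-- The scalar circle subgroup of `U(n)`. [folklore] -/
def scalarCircle : Subgroup (Matrix.unitaryGroup n ℂ) := (scalarUnitaryHom (n := n)).range

/-- Membership in the scalar circle. [folklore] -/
theorem mem_scalarCircle_iff {g : Matrix.unitaryGroup n ℂ} :
    g ∈ (scalarCircle : Subgroup (Matrix.unitaryGroup n ℂ)) ↔ ∃ z : Circle, scalarUnitary z = g :=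
  Iff.rfl

/-- The scalar circle is a normal (indeed central) subgroup of `U(n)`. [folklore] -/
theorem scalarCircle_normal : (scalarCircle : Subgroup (Matrix.unitaryGroup n ℂ)).Normal := by
  refine ⟨fun x hx g => ?_⟩
  obtain ⟨z, rfl⟩ := hx
  refine ⟨z, ?_⟩
  apply Subtype.ext
  show (z : ℂ) • (1 : Matrix n n ℂ) =
    (g : Matrix n n ℂ) * ((z : ℂ) • (1 : Matrix n n ℂ)) * ((g⁻¹ : Matrix.unitaryGroup n ℂ) : Matrix n n ℂ)
  rw [Matrix.mul_smul, Matrix.mul_one, Matrix.smul_mul, ← Submonoid.coe_mul, mul_inv_cancel,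
    Submonoid.coe_one]

/-- The scalar circle is closed in `U(n)` (compact image of `Circle`). [folklore] -/
theorem isClosed_scalarCircle :
    IsClosed ((scalarCircle : Subgroup (Matrix.unitaryGroup n ℂ)) : Set (Matrix.unitaryGroup n ℂ)) := by
  have : ((scalarCircle : Subgroup (Matrix.unitaryGroup n ℂ)) : Set (Matrix.unitaryGroup n ℂ)) =
      Set.range (scalarUnitaryHom : Circle → Matrix.unitaryGroup n ℂ) := rfl
  rw [this]
  exact (isCompact_range continuous_scalarUnitaryHom).isClosed

/-- The scalar circle is connected (continuous image of the path-connected `Circle`). [folklore] -/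
theorem isPreconnected_scalarCircle :
    IsPreconnected ((scalarCircle : Subgroup (Matrix.unitaryGroup n ℂ)) : Set (Matrix.unitaryGroup n ℂ)) := by
  have : ((scalarCircle : Subgroup (Matrix.unitaryGroup n ℂ)) : Set (Matrix.unitaryGroup n ℂ)) =
      Set.range (scalarUnitaryHom : Circle → Matrix.unitaryGroup n ℂ) := rfl
  rw [this]
  exact isPreconnected_range continuous_scalarUnitaryHom

/-- The scalar circle is non-trivial: it contains `-1 ≠ 1` (`n` non-empty). [folklore] -/
theorem scalarCircle_ne_bot [Nonempty n] : (scalarCircle : Subgroup (Matrix.unitaryGroup n ℂ)) ≠ ⊥ := by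
  intro h
  have hmem : scalarUnitary (-1) ∈ (scalarCircle : Subgroup (Matrix.unitaryGroup n ℂ)) := ⟨-1, rfl⟩
  rw [h, Subgroup.mem_bot] at hmem
  have h1 := congrArg (fun g : Matrix.unitaryGroup n ℂ => (g : Matrix n n ℂ)) hmem
  obtain ⟨i⟩ := ‹Nonempty n›
  have h2 : ((((-1 : Circle) : ℂ)) • (1 : Matrix n n ℂ)) i i = (1 : Matrix n n ℂ) i i :=
    congrFun (congrFun h1 i) i
  simp only [Matrix.smul_apply, Matrix.one_apply_eq, smul_eq_mul, mul_one, Circle.coe_neg,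
    Circle.coe_one] at h2
  norm_num at h2

/-- A diagonal sign matrix `diag(…,1,…,-1,…)` as a unitary. [folklore] -/
def signUnitary (j : n) : Matrix.unitaryGroup n ℂ :=
  ⟨Matrix.diagonal fun k => if k = j then (-1 : ℂ) else 1, by
    rw [Matrix.mem_unitaryGroup_iff, star_eq_conjTranspose, diagonal_conjTranspose, diagonal_mul_diagonal,
      ← diagonal_one]
    congr 1
    funext k
    by_cases hk : k = j <;> simp [hk]⟩

/-- The scalar circle is proper as soon as the index type has two distinct elements: the sign
unitary `diag(…,1,…,-1,…)` is not scalar. (Bröcker–tom Dieck I (1.9)–(1.10).) [folklore] -/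
theorem scalarCircle_ne_top {i j : n} (hij : i ≠ j) : (scalarCircle : Subgroup (Matrix.unitaryGroup n ℂ)) ≠ ⊤ := by
  intro h
  have hmem : signUnitary j ∈ (scalarCircle : Subgroup (Matrix.unitaryGroup n ℂ)) := by rw [h]; trivial
  obtain ⟨z, hz⟩ := hmem
  have h1 : (z : ℂ) • (1 : Matrix n n ℂ) = Matrix.diagonal fun k => if k = j then (-1 : ℂ) else 1 :=
    congrArg (fun g : Matrix.unitaryGroup n ℂ => (g : Matrix n n ℂ)) hz
  have hi : ((z : ℂ) • (1 : Matrix n n ℂ)) i i = (Matrix.diagonal fun k => if k = j then (-1 : ℂ) else 1) i i := by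
    rw [h1]
  have hj : ((z : ℂ) • (1 : Matrix n n ℂ)) j j = (Matrix.diagonal fun k => if k = j then (-1 : ℂ) else 1) j j := by
    rw [h1]
  simp only [Matrix.smul_apply, Matrix.one_apply_eq, smul_eq_mul, mul_one, Matrix.diagonal_apply_eq,
    if_neg hij] at hi hj
  rw [hi] at hj
  norm_num at hj

end Scalar

/-- **Discharge** of `not_isSimpleCompactGroup_unitaryGroup`: `U(n)` (`n` non-empty) is not a
simple compact group (Bröcker–tom Dieck I (1.9)–(1.10); Sepanski §1.3).
[cite: BrockerTomDieck1985, I (1.9)–(1.10)] -/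
theorem not_isSimpleCompactGroup_unitaryGroup_holds : not_isSimpleCompactGroup_unitaryGroup := by
  intro n _ _ _ h
  obtain ⟨-, ⟨a, b, hab⟩, hN⟩ := h
  by_cases hn : ∃ i j : n, i ≠ j
  · obtain ⟨i, j, hij⟩ := hn
    rcases hN scalarCircle scalarCircle_normal isClosed_scalarCircle isPreconnected_scalarCircle with h | h
    · exact scalarCircle_ne_bot h
    · exact scalarCircle_ne_top hij h
  · -- subsingleton index: `U(n)` is abelian
    have hn' : ∀ i j : n, i = j := fun i j => by
      by_contra hij
      exact hn ⟨i, j, hij⟩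
    apply hab
    apply Subtype.ext
    ext k l
    have hkl : ∀ m : n, m = k := fun m => hn' m k
    simp only [Submonoid.coe_mul, Matrix.mul_apply]
    have hsum : ∀ (f : n → ℂ), ∑ m, f m = f k := fun f => by
      rw [Finset.sum_eq_single k (fun m _ hm => (hm (hkl m)).elim) (fun hk => (hk (Finset.mem_univ k)).elim)]
    rw [hsum, hsum, hkl l, mul_comm]

end Literature.MathematicalPhysics.QuantumLattice

end
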